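import Mathlib
import Summits.MatrixMultiplication.MatrixMultiplication.Theorems.SnSubsetDichotomyHyperoctahedralThresholdInvolutiveSymmetry

/-!
# The far-symmetry regime of the open core `stub_poorRigidCore`
(crux `SnSubsetDichotomy.HyperoctahedralThreshold`, stmt-MatrixMultiplication-10883, live line
`Cruxes/HyperoctahedralThreshold/Lines/refutation_local_symmetry.lean`; siege k27, variation "direct pigeonhole")

Companion of `…Theorems.SnSubsetDichotomyHyperoctahedralThresholdInvolutiveSymmetry` (p115060).  Vocabulary of the
line: `μ 0, μ 1, μ 2` involutions of `Fin n`; words `w : List (Fin 3)` act on the right,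
`x · w := w.foldl (fun v c => μ c v) x`; trajectory `i ↦ x · w.take i`.

There an involutive near-symmetry `θ` made the rung walk `(y_t, θ y_t)` over ANY short closed walk clean for free.
Here `f` is ANY injective near-symmetry (commuting with the colours off an exceptional set `B`), not necessarily
involutive; a coincidence `y_s = f y_t` between the walk and its `f`-image ("`f`-chord", crux NOTES §10 (T3)) is now
genuine dirt.  The point of this file: the supply walk comes from a collision of two `B`-free walks based at ONE
vertex `x`, so `y_t = x · α`, `y_s = x · β` with `|α|, |β| ≤ r + 1`, and commuting `f` along the `B`-free `α`
(`commute_along`) turns an `f`-chord into `f x = x · (β ++ α.reverse)` — a displacement word of length `≤ 2 (r + 1)`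
AT THE BASE VERTEX.  So it suffices that the base vertex be FAR from its image, and the base vertex can be drawn from
any set `X₀` with `|X₀|·|U| + 3·2^r·(r+2)·|B| < 3·2^r·|X₀|` (at `2^r ≈ |U|`: `|X₀| > 3 (r + 2) |B|`):
`exists_closedWalk_avoiding` (the direct pigeonhole, with reachability from the base tracked through the free/cyclic
reduction `InvolutiveSymmetry.closed_of_collision`), `far_core` (explicit island form), `stub_farSymmetry` (the
quantifier shape of the core: `n ≥ 2^48`, `|R|, |E| ≤ n^{3/4}`, at least `n / 2` points `(2 ⌊log₂ n⌋ + 4)`-far,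
conclusion verbatim).  With the involutive file this leaves, of the near-automorphism traps of crux NOTES §10 (T3) /
§9E, exactly the non-involutive case in which more than half the vertices are `O(log n)`-close to their image
(rich commutator words under poorness, loc. cit.).  No poorness, rigidity or expansion is used; no definitions are
introduced.
-/

-- justification: the sub-namespace `…HyperoctahedralThreshold.FarSymmetry` repeats a path component (siblings' layout)
set_option linter.dupNamespace false

namespace Summit.MatrixMultiplication.MatrixMultiplication.Theorems.HyperoctahedralThreshold.FarSymmetry

open Finset GoodTwin InvolutiveSymmetry

variable {n : ℕ}

/-! ### The `B`-free closed-walk supply (pigeonhole at one vertex of a base set) -/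

/-- `f` commutes with a `B`-free walk: if `f (μ c v) = μ c (f v)` at every point `v ∉ B` of `U`, `U` is colour-closed,
`x ∈ U` and the proper prefixes of `α` keep `x` outside `B`, then `f (x · α) = (f x) · α`. -/
theorem commute_along (μ : Fin 3 → Equiv.Perm (Fin n)) (U B : Finset (Fin n)) (hU : ∀ c, ∀ x ∈ U, μ c x ∈ U)
    (f : Fin n → Fin n) (hf : ∀ v ∈ U, v ∉ B → ∀ c, f (μ c v) = μ c (f v)) :
    ∀ (α : List (Fin 3)) (x : Fin n), x ∈ U → (∀ j < α.length, (α.take j).foldl (fun v c => μ c v) x ∉ B) →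
      f (α.foldl (fun v c => μ c v) x) = α.foldl (fun v c => μ c v) (f x) := by
  intro α
  induction α with
  | nil => intro x _ _; rfl
  | cons c α ih =>
    intro x hx hB
    rw [List.foldl_cons, List.foldl_cons, ← hf x hx (by simpa using hB 0 (by simp)) c]
    exact ih (μ c x) (hU c x hx) fun j hj => by
      simpa [List.take_succ_cons] using hB (j + 1) (by simp only [List.length_cons]; omega)

/-- **`B`-free short closed walk near a base set.**  `μ c` involutions of `Fin n`, `U` closed under every `μ c`,
`X₀ ⊆ U` a base set and `B` any vertex set with `|X₀|·|U| + 3·2^r·(r+2)·|B| < 3·2^r·|X₀|`: some base point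
`x ∈ X₀` and some point `y` carry a non-empty cyclically reduced closed colour-walk `z` at `y`, `|z| ≤ 2 (r + 1)`, every
trajectory point of which is reached from `x` by a `B`-free walk of length `≤ r + 1`.  (Of the `3·2^r·|X₀|` reduced
words of length `r + 1` based in `X₀` at most `3·2^r·(r+2)·|B|` meet `B`, the trajectory point at a fixed time being
an injective function of the start; so some `x ∈ X₀` starts `> |U|` `B`-free walks, two of which end at the same point
of `U`; `InvolutiveSymmetry.closed_of_collision` closes them up, tracking reachability.) [this line] -/
theorem exists_closedWalk_avoiding (n r : ℕ) (μ : Fin 3 → Equiv.Perm (Fin n)) (hμ : ∀ c, μ c * μ c = 1)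
    (U X₀ B : Finset (Fin n)) (hU : ∀ c, ∀ x ∈ U, μ c x ∈ U) (hX : X₀ ⊆ U)
    (hcount : X₀.card * U.card + 3 * 2 ^ r * ((r + 2) * B.card) < 3 * 2 ^ r * X₀.card) :
    ∃ x ∈ X₀, ∃ (y : Fin n) (z : List (Fin 3)), z ≠ [] ∧ List.IsChain (· ≠ ·) (z ++ z) ∧
      z.length ≤ 2 * (r + 1) ∧ z.foldl (fun v c => μ c v) y = y ∧
      ∀ i, ∃ α : List (Fin 3), α.length ≤ r + 1 ∧
        (z.take i).foldl (fun v c => μ c v) y = α.foldl (fun v c => μ c v) x ∧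
        ∀ j, (α.take j).foldl (fun v c => μ c v) x ∉ B := by
  classical
  obtain ⟨F, hF, hF'⟩ := TwinSupply.exists_reducedWords r
  -- based walks `(x, cb)`; the BAD ones meet `B` at some time `j ≤ r + 1`
  let Bad : Finset (Fin n × (Fin 3 × (Fin r → Fin 2))) :=
    ((range (r + 2)) ×ˢ (univ : Finset (Fin 3 × (Fin r → Fin 2)))).biUnion fun jc =>
      (univ.filter fun x : Fin n => ((F jc.2).take jc.1).foldl (fun v c => μ c v) x ∈ B).image
        fun x => (x, jc.2)
  have memBad : ∀ (a : Fin n × (Fin 3 × (Fin r → Fin 2))) (j : ℕ), j < r + 2 →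
      ((F a.2).take j).foldl (fun v c => μ c v) a.1 ∈ B → a ∈ Bad := fun a j hj hm =>
    mem_biUnion.2 ⟨(j, a.2), mem_product.2 ⟨mem_range.2 hj, mem_univ _⟩,
      mem_image.2 ⟨a.1, mem_filter.2 ⟨mem_univ _, hm⟩, rfl⟩⟩
  have hBad : Bad.card ≤ 3 * 2 ^ r * ((r + 2) * B.card) := by
    calc Bad.card ≤ ((range (r + 2)) ×ˢ (univ : Finset (Fin 3 × (Fin r → Fin 2)))).card * B.card :=
          card_biUnion_le_card_mul _ _ _ fun jc _ =>
            card_image_le.trans (card_le_card_of_injOn (fun x => ((F jc.2).take jc.1).foldl (fun v c => μ c v) x)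
              (fun x hx => (mem_filter.1 (mem_coe.1 hx)).2) (foldl_injective μ _).injOn)
      _ = 3 * 2 ^ r * ((r + 2) * B.card) := by
          rw [card_product, card_range, card_univ, Fintype.card_prod, Fintype.card_fin, Fintype.card_fun,
            Fintype.card_fin, Fintype.card_fin]
          ring
  -- the GOOD walks based in `X₀` avoid `B` at all times; there are `> |X₀| |U|` of them
  let Good : Finset (Fin n × (Fin 3 × (Fin r → Fin 2))) := (X₀ ×ˢ univ) \ Bad
  have hGood : ∀ a ∈ Good, ∀ i : ℕ, ((F a.2).take i).foldl (fun v c => μ c v) a.1 ∉ B := by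
    intro a ha i hm
    refine (mem_sdiff.1 ha).2 ?_
    rcases Nat.lt_or_ge (r + 1) i with hi | hi
    · refine memBad a (r + 1) (by omega) ?_
      have hl : (F a.2).length ≤ i := by rw [(hF' a.2).2]; omega
      rwa [List.take_of_length_le hl, ← List.take_of_length_le (le_of_eq (hF' a.2).2)] at hm
    · exact memBad a i (by omega) hm
  have hGood_card : X₀.card * U.card < Good.card := by
    have hΩ : (X₀ ×ˢ (univ : Finset (Fin 3 × (Fin r → Fin 2)))).card = 3 * 2 ^ r * X₀.card := by
      rw [card_product, card_univ, Fintype.card_prod, Fintype.card_fin, Fintype.card_fun, Fintype.card_fin,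
        Fintype.card_fin]
      ring
    have hG : (X₀ ×ˢ (univ : Finset (Fin 3 × (Fin r → Fin 2)))).card ≤ Good.card + Bad.card :=
      card_le_card_sdiff_add_card
    rw [hΩ] at hG
    set X := 3 * 2 ^ r * X₀.card
    set Y := 3 * 2 ^ r * ((r + 2) * B.card)
    omega
  -- pigeonhole 1: a base vertex `x ∈ X₀` with `> |U|` good words; pigeonhole 2: two with the same endpoint (in `U`)
  obtain ⟨x, hxX, hx⟩ := exists_lt_card_fiber_of_mul_lt_card_of_maps_to (s := Good) (t := X₀) (f := Prod.fst)
    (fun a ha => (mem_product.1 (mem_sdiff.1 ha).1).1) hGood_card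
  have hxU : x ∈ U := hX hxX
  obtain ⟨a, ha, a', ha', hne, hcoll⟩ := exists_ne_map_eq_of_card_lt_of_maps_to (t := U)
    (f := fun a : Fin n × (Fin 3 × (Fin r → Fin 2)) => (F a.2).foldl (fun v c => μ c v) x)
    hx (fun a _ => foldl_mem μ U hU _ x hxU)
  have hax : a.1 = x := (mem_filter.1 ha).2
  have hax' : a'.1 = x := (mem_filter.1 ha').2
  have hww : F a.2 ≠ F a'.2 := fun h => hne (Prod.ext (hax.trans hax'.symm) (hF h))
  -- reachability from `x` by a `B`-free walk of length `≤ r + 1`, tracked through the reduction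
  have reach : ∀ b ∈ Good, b.1 = x → ∀ i, ∃ α : List (Fin 3), α.length ≤ r + 1 ∧
      ((F b.2).take i).foldl (fun v c => μ c v) x = α.foldl (fun v c => μ c v) x ∧
      ∀ j, (α.take j).foldl (fun v c => μ c v) x ∉ B := fun b hb hbx i =>
    ⟨(F b.2).take i, (List.length_take_le' _ _).trans (hF' b.2).2.le, rfl, fun j => by
      rw [List.take_take]; exact hbx ▸ hGood b hb _⟩
  obtain ⟨y, z, hz0, hzc, hzlen, hfix, hP⟩ := closed_of_collision μ hμ
    (fun v => ∃ α : List (Fin 3), α.length ≤ r + 1 ∧ v = α.foldl (fun v c => μ c v) x ∧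
      ∀ j, (α.take j).foldl (fun v c => μ c v) x ∉ B)
    _ (F a.2) (F a'.2) x le_rfl (by rw [(hF' a.2).2, (hF' a'.2).2]) hww (hF' a.2).1 (hF' a'.2).1 hcoll
    (reach a (mem_filter.1 ha).1 hax) (reach a' (mem_filter.1 ha').1 hax')
  rw [(hF' a.2).2, (hF' a'.2).2] at hzlen
  exact ⟨x, hxX, y, z, hz0, hzc, by omega, hfix, hP⟩

/-- **The far-symmetry regime of the core, explicit form.**  `μ c` involutions of `Fin n`, `U` closed under every
`μ c`, `f` an injective map, `R, B` sets such that every `v ∈ U ∖ B` satisfies `f (μ c v) = μ c (f v)` for all `c`,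
`v ∉ R`, `f v ∉ R`; `X₀ ⊆ U` a set of FAR points: no colour word of length `≤ 2 (r + 1)` carries `x ∈ X₀` to `f x`.
If `|X₀|·|U| + 3·2^r·(r+2)·|B| < 3·2^r·|X₀|` (at `2^r ≥ |U|`: `|X₀| > 3 (r + 2) |B|` suffices) then there is a clean
closed colour-walk of the rung graph avoiding `R` in the format of the conclusion of `stub_poorRigidCore`,
`2 ≤ k + 1 ≤ 2 (r + 1)` rungs: the twin rung walk `t ↦ (y_t, f y_t)` over the closed walk of
`exists_closedWalk_avoiding`; two of its rungs sharing a point would be an `f`-chord `y_s = f y_t`, and since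
`y_t = x · α`, `y_s = x · β` along `B`-free walks from the base `x`, commuting `f` along `α` (`commute_along`) gives
`f x = x · (β ++ α.reverse)`, a displacement word of length `≤ 2 (r + 1)` at the far point `x`.  Companion of
`InvolutiveSymmetry.involutive_core` (there `f` is involutive and chords are harmless). [this line] -/
theorem far_core (n r : ℕ) (μ : Fin 3 → Equiv.Perm (Fin n)) (hμ : ∀ c, μ c * μ c = 1)
    (U X₀ : Finset (Fin n)) (hU : ∀ c, ∀ x ∈ U, μ c x ∈ U) (hX : X₀ ⊆ U) (f : Fin n → Fin n)
    (hf : Function.Injective f) (R B : Finset (Fin n))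
    (hB : ∀ v ∈ U, v ∉ B → (∀ c, f (μ c v) = μ c (f v)) ∧ v ∉ R ∧ f v ∉ R)
    (hfar : ∀ x ∈ X₀, ∀ u : List (Fin 3), u.length ≤ 2 * (r + 1) → u.foldl (fun v c => μ c v) x ≠ f x)
    (hcount : X₀.card * U.card + 3 * 2 ^ r * ((r + 2) * B.card) < 3 * 2 ^ r * X₀.card) :
    ∃ (k : ℕ) (p q : Fin (k + 1) → Fin n) (col : Fin (k + 1) → Fin 3),
      (∀ i, p i ≠ q i) ∧
      (∀ i, (μ (col i) (p i) = p (i + 1) ∧ μ (col i) (q i) = q (i + 1)) ∨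
        (μ (col i) (p i) = q (i + 1) ∧ μ (col i) (q i) = p (i + 1))) ∧
      (∀ i, col i ≠ col (i + 1)) ∧
      (∀ i j, (p i = p j ∧ q i = q j) ∨ (p i = q j ∧ q i = p j) ∨
        (p i ≠ p j ∧ p i ≠ q j ∧ q i ≠ p j ∧ q i ≠ q j)) ∧
      (∀ i, p i ∉ R ∧ q i ∉ R) ∧ 2 ≤ k + 1 ∧ k + 1 ≤ 2 * (r + 1) := by
  obtain ⟨x, hxX, y, z, hz0, hzc, hzlen, hfix, hP⟩ := exists_closedWalk_avoiding n r μ hμ U X₀ B hU hX hcount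
  have hxU : x ∈ U := hX hxX
  have hℓ2 : 2 ≤ z.length := by
    match z, hz0, hzc with
    | [c], _, hc => simp at hc
    | _ :: _ :: _, _, _ => simp
  obtain ⟨k, hk⟩ : ∃ k, z.length = k + 1 := ⟨z.length - 1, by omega⟩
  have hval : ∀ t : Fin (k + 1), ((t + 1 : Fin (k + 1)) : ℕ) = ((t : ℕ) + 1) % z.length := by
    intro t
    rw [Fin.val_add, hk]
    simp
  -- the twin rung walk `t ↦ (y · z.take t, f (y · z.take t))`
  set Pt : Fin (k + 1) → Fin n := fun t => (z.take (t : ℕ)).foldl (fun v c => μ c v) y with hPt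
  -- trajectory points are `B`-free points of `U`
  have hPU : ∀ t : Fin (k + 1), Pt t ∈ U ∧ Pt t ∉ B := by
    intro t
    obtain ⟨α, -, hα, hαB⟩ := hP t
    have h1 : Pt t = α.foldl (fun v c => μ c v) x := hα
    refine ⟨h1 ▸ foldl_mem μ U hU α x hxU, ?_⟩
    rw [h1, ← List.take_length (l := α)]
    exact hαB _
  have hfP : ∀ t : Fin (k + 1), (∀ c, f (μ c (Pt t)) = μ c (f (Pt t))) ∧ Pt t ∉ R ∧ f (Pt t) ∉ R :=
    fun t => hB _ (hPU t).1 (hPU t).2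
  -- no `f`-chords: `Pt s ≠ f (Pt t)` (else a displacement word of length `≤ 2 (r + 1)` at the far base `x`)
  have nochord : ∀ s t : Fin (k + 1), Pt s ≠ f (Pt t) := by
    intro s t h
    obtain ⟨α, hαl, hα, hαB⟩ := hP t
    obtain ⟨β, hβl, hβ, -⟩ := hP s
    have hft : f (Pt t) = α.foldl (fun v c => μ c v) (f x) := by
      rw [show Pt t = α.foldl (fun v c => μ c v) x from hα]
      exact commute_along μ U B hU f (fun v hv hvB => (hB v hv hvB).1) α x hxU fun j _ => hαB j
    refine hfar x hxX (β ++ α.reverse) (by simp only [List.length_append, List.length_reverse]; omega) ?_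
    rw [List.foldl_append, ← show Pt s = β.foldl (fun v c => μ c v) x from hβ, h, hft]
    exact Rotation.foldl_act_reverse μ hμ α (f x)
  refine ⟨k, Pt, fun t => f (Pt t), fun t => z[(t : ℕ)]'(by omega), fun t => nochord t t, ?_, ?_, ?_, ?_,
    by omega, by omega⟩
  · intro t
    left
    have step : μ z[(t : ℕ)] (Pt t) = Pt (t + 1) := by
      simp only [hPt]
      rw [foldl_take_step μ z y hfix t (by omega), hval]
    exact ⟨step, by rw [← (hfP t).1, step]⟩
  · intro t
    exact cyclic_ne hzc t _ (by omega) (by rw [hval]; exact Nat.mod_lt _ (by omega)) (hval t)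
  · intro i j
    dsimp only
    by_cases h1 : Pt i = Pt j
    · exact Or.inl ⟨h1, by rw [h1]⟩
    · exact Or.inr (Or.inr ⟨h1, nochord i j, fun h => nochord j i h.symm, fun h => h1 (hf h)⟩)
  · exact fun t => ⟨(hfP t).2.1, (hfP t).2.2⟩

/-- Numerics of the scale `r = ⌊log₂ n⌋ + 1` for the far regime: `(36 (m + 3))⁴ ≤ 2^m` for `m ≥ 48`. -/
theorem numeric_key36 : ∀ m, 48 ≤ m → (36 * (m + 3)) ^ 4 ≤ 2 ^ m := by
  intro m hm
  induction m, hm using Nat.le_induction with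
  | base => norm_num
  | succ m hm ih =>
    have e1 : (m + 3) ^ 2 ≤ (m + 3) ^ 3 := Nat.pow_le_pow_right (by omega) (by norm_num)
    have e2 : (m + 3) ≤ (m + 3) ^ 2 := by nlinarith
    have e3 : 43 * (m + 3) ^ 3 ≤ (m + 3) ^ 4 := by
      calc 43 * (m + 3) ^ 3 ≤ (m + 3) * (m + 3) ^ 3 := Nat.mul_le_mul_right _ (by omega)
        _ = (m + 3) ^ 4 := by ring
    have h1 : (m + 4) ^ 4 ≤ 2 * (m + 3) ^ 4 := by
      rw [(by ring : (m + 4) ^ 4 = (m + 3) ^ 4 + (4 * (m + 3) ^ 3 + 6 * (m + 3) ^ 2 + 4 * (m + 3) + 1))]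
      linarith
    calc (36 * (m + 1 + 3)) ^ 4 = 36 ^ 4 * (m + 4) ^ 4 := by ring
      _ ≤ 36 ^ 4 * (2 * (m + 3) ^ 4) := Nat.mul_le_mul_left _ h1
      _ = 2 * (36 * (m + 3)) ^ 4 := by ring
      _ ≤ 2 * 2 ^ m := Nat.mul_le_mul_left _ ih
      _ = 2 ^ (m + 1) := by ring

/-- **The far-symmetry regime of `stub_poorRigidCore`** (registered `--supports` form `stub_farSymmetry`; the core's
conclusion verbatim, its host and forbidden-set hypotheses verbatim, poorness and rigidity NOT needed): for
`n ≥ 2^48`, three fixed-point-free involutions `μ i`, `|R| ≤ n^{3/4}`, an injective map `f` commuting with the three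
colours off an exceptional set `|E| ≤ n^{3/4}`, and a set `X₀` of at least `n / 2` FAR points (no colour word of
length `≤ 2 ⌊log₂ n⌋ + 4` carries `x` to `f x`), there is a clean closed colour-walk of the rung graph avoiding `R`
with `k + 1 ≤ n^{1/4}` rungs.  Proof: `far_core` on `U = univ` at `r = ⌊log₂ n⌋ + 1` with `B := R ∪ E ∪ f⁻¹(R)`
(`|B| ≤ 3 n^{3/4}`, `12 (r + 2) |B| ≤ 36 (r + 2) n^{3/4} ≤ n` and `k + 1 ≤ 2 r + 2 ≤ n^{1/4}` by `numeric_key36`).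
[this line] -/
theorem stub_farSymmetry : ∃ n₀ : ℕ, ∀ n ≥ n₀, ∀ μ : Fin 3 → Equiv.Perm (Fin n), (∀ i, μ i * μ i = 1 ∧ ∀ v, μ i v ≠ v) → ∀ R : Finset (Fin n), (R.card : ℝ) ≤ (n : ℝ) ^ ((3 : ℝ) / 4) → ∀ (f : Fin n → Fin n) (E X₀ : Finset (Fin n)), Function.Injective f → (E.card : ℝ) ≤ (n : ℝ) ^ ((3 : ℝ) / 4) → (∀ x, x ∉ E → ∀ c, f (μ c x) = μ c (f x)) → n ≤ 2 * X₀.card → (∀ x ∈ X₀, ∀ u : List (Fin 3), u.length ≤ 2 * Nat.log 2 n + 4 → u.foldl (fun v c => μ c v) x ≠ f x) → ∃ (k : ℕ) (p q : Fin (k + 1) → Fin n) (col : Fin (k + 1) → Fin 3), (∀ i, p i ≠ q i) ∧ (∀ i, (μ (col i) (p i) = p (i + 1) ∧ μ (col i) (q i) = q (i + 1)) ∨ (μ (col i) (p i) = q (i + 1) ∧ μ (col i) (q i) = p (i + 1))) ∧ (∀ i, col i ≠ col (i + 1)) ∧ (∀ i j, (p i = p j ∧ q i = q j) ∨ (p i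 = q j ∧ q i = p j) ∨ (p i ≠ p j ∧ p i ≠ q j ∧ q i ≠ p j ∧ q i ≠ q j)) ∧ (∀ i, p i ∉ R ∧ q i ∉ R) ∧ ((k : ℝ) + 1) ≤ (n : ℝ) ^ ((1 : ℝ) / 4) := by
  refine ⟨2 ^ 48, fun n hn μ hμ R hR f E X₀ hf hE hfE hX hfar => ?_⟩
  classical
  -- the scale `m = ⌊log₂ n⌋`
  set m := Nat.log 2 n with hm
  have hn0 : n ≠ 0 := by rintro rfl; exact absurd hn (by norm_num)
  have h2m : 2 ^ m ≤ n := Nat.pow_log_le_self 2 hn0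
  have hn2 : n < 2 ^ (m + 1) := Nat.lt_pow_succ_log_self one_lt_two n
  have key : (36 * (m + 3)) ^ 4 ≤ n := (numeric_key36 m (Nat.le_log_of_pow_le one_lt_two hn)).trans h2m
  -- the bad set `B := R ∪ E ∪ f⁻¹(R)`
  let B : Finset (Fin n) := R ∪ E ∪ (univ.filter fun x => f x ∈ R)
  have hBR : ∀ v ∈ (univ : Finset (Fin n)), v ∉ B → (∀ c, f (μ c v) = μ c (f v)) ∧ v ∉ R ∧ f v ∉ R := by
    intro v _ hv
    simp only [B, mem_union, mem_filter, mem_univ, true_and, not_or] at hv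
    exact ⟨hfE v hv.1.2, hv.1.1, hv.2⟩
  have hBcard : B.card ≤ R.card + E.card + R.card :=
    (card_union_le _ _).trans (add_le_add (card_union_le _ _)
      (card_le_card_of_injOn f (fun x hx => (mem_filter.1 (mem_coe.1 hx)).2) hf.injOn))
  -- `36 (m + 3) ≤ n^{1/4}`, hence `12 (m + 3) |B| ≤ n`
  have hnpos : (0 : ℝ) < n := by exact_mod_cast Nat.pos_of_ne_zero hn0
  have hkey : ((36 * (m + 3) : ℕ) : ℝ) ≤ (n : ℝ) ^ ((1 : ℝ) / 4) := by
    have h1 : (((36 * (m + 3) : ℕ) : ℝ)) ^ 4 ≤ (n : ℝ) := by exact_mod_cast key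
    have e : ((((36 * (m + 3) : ℕ) : ℝ)) ^ 4) ^ ((1 : ℝ) / 4) = ((36 * (m + 3) : ℕ) : ℝ) := by
      rw [one_div]
      exact Real.pow_rpow_inv_natCast (by positivity) four_ne_zero
    exact e.symm.trans_le (Real.rpow_le_rpow (by positivity) h1 (by norm_num))
  have hB12 : ((12 * (m + 3) * B.card : ℕ) : ℝ) ≤ n := by
    have hb : (B.card : ℝ) ≤ 3 * (n : ℝ) ^ ((3 : ℝ) / 4) := by
      have : (B.card : ℝ) ≤ R.card + E.card + R.card := by exact_mod_cast hBcard
      linarith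
    calc ((12 * (m + 3) * B.card : ℕ) : ℝ) = 12 * ((m : ℝ) + 3) * B.card := by push_cast; ring
      _ ≤ 12 * ((m : ℝ) + 3) * (3 * (n : ℝ) ^ ((3 : ℝ) / 4)) := by gcongr
      _ = ((36 * (m + 3) : ℕ) : ℝ) * (n : ℝ) ^ ((3 : ℝ) / 4) := by push_cast; ring
      _ ≤ (n : ℝ) ^ ((1 : ℝ) / 4) * (n : ℝ) ^ ((3 : ℝ) / 4) := by gcongr
      _ = n := by rw [← Real.rpow_add hnpos]; norm_num
  have hB12' : 12 * (m + 3) * B.card ≤ n := by exact_mod_cast hB12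
  have hXn : X₀.card ≤ n := (card_le_univ X₀).trans (by rw [Fintype.card_fin])
  -- the counting hypothesis of `far_core` at `r = m + 1`, `U = univ`
  have hcount : X₀.card * n + 3 * 2 ^ (m + 1) * ((m + 1 + 2) * B.card) < 3 * 2 ^ (m + 1) * X₀.card := by
    have h2 : 2 ^ (m + 1) ≤ 2 * n := by rw [pow_succ]; omega
    have h3 : 2 * (3 * 2 ^ (m + 1) * ((m + 1 + 2) * B.card)) ≤ n * n := by
      calc 2 * (3 * 2 ^ (m + 1) * ((m + 1 + 2) * B.card)) = 2 ^ (m + 1) * (12 * (m + 3) * B.card) / 2 := by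
            rw [show 2 ^ (m + 1) * (12 * (m + 3) * B.card) = 2 * (2 * (3 * 2 ^ (m + 1) * ((m + 1 + 2) * B.card)))
              by ring, Nat.mul_div_cancel_left _ two_pos]
        _ ≤ (2 * n) * n / 2 := Nat.div_le_div_right (Nat.mul_le_mul h2 hB12')
        _ = n * n := by rw [mul_assoc, Nat.mul_div_cancel_left _ two_pos]
    have h4 : 3 * (n + 1) * X₀.card ≤ 3 * 2 ^ (m + 1) * X₀.card :=
      Nat.mul_le_mul_right _ (Nat.mul_le_mul_left _ hn2)
    nlinarith
  obtain ⟨k, p, q, col, h1, h2, h3, h4, h5, -, h7⟩ := far_core n (m + 1) μ (fun c => (hμ c).1) univ X₀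
    (fun c x _ => mem_univ _) (subset_univ _) f hf R B hBR (fun x hx u hu => hfar x hx u (by omega))
    (by rw [card_univ, Fintype.card_fin]; exact hcount)
  exact ⟨k, p, q, col, h1, h2, h3, h4, h5, le_trans (by exact_mod_cast (by omega : k + 1 ≤ 36 * (m + 3))) hkey⟩

end Summit.MatrixMultiplication.MatrixMultiplication.Theorems.HyperoctahedralThreshold.FarSymmetry
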